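import Summits.HubbardSuperconductivity.HubbardSuperconductivity.Theorems.SoloBlindCooperTrial
import Summits.HubbardSuperconductivity.HubbardSuperconductivity.Theorems.SoloBlindCooperArith
import Summits.HubbardSuperconductivity.HubbardSuperconductivity.Theorems.SoloBlindCooperBlocks
import Summits.HubbardSuperconductivity.HubbardSuperconductivity.Theorems.SoloBlindFermiSurfaceWindows
import Summits.HubbardSuperconductivity.HubbardSuperconductivity.Theorems.SoloBlindFermiLevel
import Summits.HubbardSuperconductivity.HubbardSuperconductivity.Theorems.SoloBlindVariationalCrutch
import HarnessLib

/-!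
# The Cooper trial state at fixed particle number (solo-blind programme, Theorem 29)

For the free Hamiltonian crutched by the `d`-wave pair attraction, `H₀ - (g/L²)ΔᴴΔ` (`U = 0`), at
every coupling `g > 0` and every doping `δ ∈ (0, 1/2)`: for every depth `J` with
`(49g/225)(J+1)·3/(2048π²) ≥ 8` and every even side `L` beyond explicit thresholds, the summit's
sector `(2⌊(1-δ)L²/2⌋, S^z = 0)` contains a nonzero vector whose crutched energy lies
`κ_J L²` below the free sector minimum, `κ_J = 3(J+1)/(1024π²16^J)` (`exists_cooper_trial`).

The vector is the number-projected weighted condensate on the block data of Theorems 27′/27c/28(f)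
(dyadic Fermi-surface windows `W^±_j`, `j ≤ J`, reciprocal weights `(4^j/4^J)^{±2}`, far modes at
weight `X^{∓1}`); the estimate is Theorem 28(d)/(e) with the window lower count `#W_j·4^j ≥ σL²`,
`σ = 3/(2048π²)`: cost `≤ 4S/16^J + κL²`, gain `≥ (g/L²)(7S/(15·4^J))²`, `S = Σ_j #W_j4^j ≥ (J+1)σL²`
— the Cooper logarithm is the factor `J+1`. No gap equation, no saddle point, no van Hove analysis.
[this work]
-/

noncomputable section

namespace Summit.HubbardSuperconductivity.HubbardSuperconductivity.Theorems.CooperPairing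

open Matrix Finset Real Literature.Probability.LatticeModels
  Literature.MathematicalPhysics.QuantumLattice
  Summit.HubbardSuperconductivity.HubbardSuperconductivity.Theorems.EnergyBalance
  Summit.HubbardSuperconductivity.HubbardSuperconductivity.Theorems.CooperBlocks
  Summit.HubbardSuperconductivity.HubbardSuperconductivity.Theorems.FermiSurfaceDOS
  Summit.HubbardSuperconductivity.HubbardSuperconductivity.Theorems.FermiLevel
open scoped ComplexOrder

variable {L : ℕ} [NeZero L]

/-- The `d`-wave profile `w_k = pairFieldMode dWaveFormFactor L k`. -/
local notation "W[" k "]" => (pairFieldMode dWaveFormFactor _ k)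

/-- **Theorem 29 (the Cooper trial state at fixed particle number).** [this work] -/
theorem exists_cooper_trial (hL3 : 3 ≤ L) (hLe : Even L) {δ : ℝ} (hδ0 : 0 < δ)
    (hδ1 : δ < 1 / 2) (hLδ : 4 / (1 - 2 * δ) ≤ (L : ℝ) ^ 2) (J : ℕ) {g : ℝ} (hg : 0 < g)
    (hL1 : 64 * π ≤ L) (hL2 : 64 * π / 3 * 4 ^ J ≤ 1 / 2 * (L : ℝ))
    (hL4 : 48 * 4 ^ J < 3 / (2048 * π ^ 2) * (L : ℝ) ^ 2)
    (hJ : 8 ≤ 49 * g / 225 * ((J + 1) * (3 / (2048 * π ^ 2)))) :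
    ∃ Ψ : Fock (Orb (FermionTorus 2 L)),
      Ψ ∈ szSector (Λ := FermionTorus 2 L) (2 * ⌊(1 - δ) * (L : ℝ) ^ 2 / 2⌋₊) 0 ∧ Ψ ≠ 0 ∧
        (star Ψ ⬝ᵥ (hubbardTorus 2 L 1 0 + ((-(g / (L : ℝ) ^ 2) : ℝ) : ℂ) •
            ((pairField dWaveFormFactor L)ᴴ * pairField dWaveFormFactor L)) *ᵥ Ψ).re ≤
          ((hubbardTorus 2 L 1 0).minEnergyOn
              (szSector (Λ := FermionTorus 2 L) (2 * ⌊(1 - δ) * (L : ℝ) ^ 2 / 2⌋₊) 0) -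
            3 * (J + 1) / (1024 * π ^ 2 * 16 ^ J) * (L : ℝ) ^ 2) * (star Ψ ⬝ᵥ Ψ).re := by
  classical
  -- the sector, the Fermi set, the windows, the blocks
  have hL0 : 0 < L := by omega
  have hLr : (0 : ℝ) < L := by exact_mod_cast hL0
  obtain ⟨h4n, h2n⟩ := sector_card_bounds hδ0 hδ1 hL0 hLδ
  set n := ⌊(1 - δ) * (L : ℝ) ^ 2 / 2⌋₊ with hn
  have h9 : 3 ^ 2 ≤ L ^ 2 := Nat.pow_le_pow_left hL3 2
  obtain ⟨M, hM⟩ : ∃ M, n = M + 2 := ⟨n - 2, by omega⟩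
  obtain ⟨F, μ, hFn, hμ1, hμ2, hFμ, hFμ'⟩ := exists_fermiSet_level hLe h4n h2n
  obtain ⟨m, Wp, Wm, hm1, -, hcP, hcM, hWp, hWm, hdP, hdM⟩ :=
    exists_dyadic_windows L μ hμ1 hμ2 (1 / 2) (by norm_num) le_rfl
  have hWpF : ∀ j, Disjoint (Wp j) F := fun j => disjoint_left.2 fun k hk hkF => by
    have h1 := (hWp j k hk).1; have h2 := hFμ k hkF; linarith
  have hWmF : ∀ j, Wm j ⊆ F := fun j k hk => by
    by_contra hkF; have h1 := (hWm j k hk).2.1; have h2 := hFμ' k hkF; linarith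
  have hcardW : ∀ j, #(Wp j) = #(Wm j) := fun j => by rw [hcP, hcM]
  have h2F : 2 * #F ≤ Fintype.card (TorusSite 2 L) := by rw [card_torusSite_two, hFn]; omega
  obtain ⟨A, R, C, col, hFA, hAF, hAFeq, hdUR, hFeq, hdUC, hRC, hfib, hcolP, hcolM, hcolR,
    hcolC⟩ := exists_blocks F Wp Wm J hWpF hWmF hcardW hdP hdM h2F
  set Up := (range (J + 1)).biUnion Wp with hUp
  set Um := (range (J + 1)).biUnion Wm with hUm
  have hpdP : (↑(range (J + 1)) : Set ℕ).PairwiseDisjoint Wp := fun i _ j _ hij => hdP i j hij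
  have hpdM : (↑(range (J + 1)) : Set ℕ).PairwiseDisjoint Wm := fun i _ j _ hij => hdM i j hij
  have hUpF : Disjoint Up F := (disjoint_biUnion_left _ _ _).2 fun j _ => hWpF j
  have hUmF : Um ⊆ F := biUnion_subset.2 fun j _ => hWmF j
  have hUpA : Up ⊆ A := fun k hk => (mem_sdiff.1 (hAFeq ▸ mem_union_left R hk)).1
  have hRA : R ⊆ A \ F := fun k hk => hAFeq ▸ mem_union_right _ hk
  have hCF : C ⊆ F := fun k hk => hFeq ▸ mem_union_right _ hk
  -- the constants and the weights
  set q : ℝ := 4 ^ J with hq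
  have hq0 : 0 < q := by positivity
  set σ : ℝ := 3 / (2048 * π ^ 2) with hσ
  set κ : ℝ := 2 * σ * (J + 1) / q ^ 2 with hκ
  set X : ℝ := 20 / κ with hX
  have hσ0 : 0 < σ := by positivity
  have hκ0 : 0 < κ := by positivity
  have hX0 : 0 < X := by positivity
  obtain ⟨r, hr⟩ : ∃ r : ℕ → ℝ, ∀ j, r j = 4 ^ j / q := ⟨_, fun _ => rfl⟩
  have hr0 : ∀ j, 0 < r j := fun j => by rw [hr]; positivity
  have hr1 : ∀ j < J + 1, r j ≤ 1 := fun j hj => by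
    rw [hr, div_le_one hq0, hq]
    exact pow_le_pow_right₀ (by norm_num) (by omega)
  obtain ⟨a, ha⟩ : ∃ a : ℕ → ℝ, ∀ j, a j = if j < J + 1 then r j ^ 2 else 1 / X :=
    ⟨_, fun _ => rfl⟩
  have ha0 : ∀ j, 0 < a j := fun j => by
    rw [ha]; split_ifs
    · exact pow_pos (hr0 j) 2
    · positivity
  have haW : ∀ j < J + 1, a j = r j ^ 2 := fun j hj => by rw [ha, if_pos hj]
  have haX : a (J + 1) = 1 / X := by rw [ha, if_neg (lt_irrefl _)]
  obtain ⟨x, hx⟩ : ∃ x : TorusSite 2 L → ℝ,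
      ∀ k, x k = if k ∈ F then (a (col k))⁻¹ else a (col k) := ⟨_, fun _ => rfl⟩
  obtain ⟨gw, hgw⟩ : ∃ gw : TorusSite 2 L → ℝ,
      ∀ k, gw k = if k ∈ Up ∪ Um then r (col k) / 3 else 0 := ⟨_, fun _ => rfl⟩
  have hx0 : ∀ k, 0 ≤ x k := fun k => by
    rw [hx]; split_ifs
    · exact inv_nonneg.2 (ha0 _).le
    · exact (ha0 _).le
  have hxP : ∀ k ∈ A \ F, x k = a (col k) := fun k hk => by
    rw [hx, if_neg (mem_sdiff.1 hk).2]
  have hxQ : ∀ k ∈ F, x k = (a (col k))⁻¹ := fun k hk => by rw [hx, if_pos hk]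
  -- values on the four kinds of modes
  have xWp : ∀ j < J + 1, ∀ k ∈ Wp j, x k = r j ^ 2 := fun j hj k hk => by
    rw [hx, if_neg (disjoint_left.1 (hWpF j) hk), hcolP j hj k hk, haW j hj]
  have xWm : ∀ j < J + 1, ∀ k ∈ Wm j, x k = (r j ^ 2)⁻¹ := fun j hj k hk => by
    rw [hx, if_pos (hWmF j hk), hcolM j hj k hk, haW j hj]
  have xR : ∀ k ∈ R, x k = 1 / X := fun k hk => by
    rw [hxP k (hRA hk), hcolR k hk, haX]
  have xC : ∀ k ∈ C, x k = X := fun k hk => by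
    rw [hxQ k (hCF hk), hcolC k hk, haX, one_div, inv_inv]
  have gWp : ∀ j < J + 1, ∀ k ∈ Wp j, gw k = r j / 3 := fun j hj k hk => by
    rw [hgw, if_pos (mem_union_left _ (mem_biUnion.2 ⟨j, mem_range.2 hj, hk⟩)), hcolP j hj k hk]
  have gWm : ∀ j < J + 1, ∀ k ∈ Wm j, gw k = r j / 3 := fun j hj k hk => by
    rw [hgw, if_pos (mem_union_right _ (mem_biUnion.2 ⟨j, mem_range.2 hj, hk⟩)), hcolM j hj k hk]
  -- the window lower count `#W_j · 4^j ≥ σ L²`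
  have hslow : ∀ j < J + 1, σ * (L : ℝ) ^ 2 ≤ #(Wp j) * 4 ^ j := by
    intro j hj
    have h4j : (4 : ℝ) ^ j ≤ q := hq ▸ pow_le_pow_right₀ (by norm_num) (by omega)
    have h4j0 : (0 : ℝ) < 4 ^ j := by positivity
    have hz : 4 ≤ 3 * (1 / 2 / 4 ^ j) * L / (16 * π) := by
      rw [le_div_iff₀ (by positivity)]
      have : 64 * π / 3 * 4 ^ j ≤ 1 / 2 * (L : ℝ) :=
        (mul_le_mul_of_nonneg_left h4j (by positivity)).trans hL2
      rw [div_mul_eq_mul_div, div_le_iff₀ (by norm_num : (0 : ℝ) < 3)] at this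
      have e : 3 * (1 / 2 / 4 ^ j) * (L : ℝ) * 4 ^ j = 3 * (1 / 2 * L) := by field_simp
      nlinarith only [e, this, h4j0]
    have hceil : 3 * (1 / 2 / 4 ^ j) * L / (16 * π) / 2 ≤
        (⌈3 * (1 / 2 / 4 ^ j) * L / (16 * π) - 2⌉₊ : ℝ) :=
      le_trans (by linarith) (Nat.le_ceil _)
    have hm' : (L : ℝ) / (32 * π) ≤ m := by
      have : (L : ℝ) / (32 * π) ≤ L / (16 * π) - 2 := by
        rw [div_le_iff₀ (by positivity : (0 : ℝ) < 32 * π)]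
        have e : ((L : ℝ) / (16 * π) - 2) * (32 * π) = 2 * L - 64 * π := by
          field_simp
          ring
        rw [e]
        linarith only [hL1]
      exact this.trans hm1
    have hcard : (#(Wp j) : ℝ) = m * ⌈3 * (1 / 2 / 4 ^ j) * L / (16 * π) - 2⌉₊ := by
      rw [hcP j]; push_cast; ring
    have hprod := mul_le_mul hm' hceil (by positivity) (by positivity)
    have e : (L : ℝ) / (32 * π) * (3 * (1 / 2 / 4 ^ j) * L / (16 * π) / 2) * 4 ^ j =
        σ * (L : ℝ) ^ 2 := by
      rw [hσ]; field_simp; ring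
    rw [← e, hcard]
    exact mul_le_mul_of_nonneg_right hprod h4j0.le
  -- the variance: the top window alone carries `#W_J / 4 > 12`
  have hJm : J < J + 1 := Nat.lt_succ_self J
  have hrJ : r J = 1 := by rw [hr, hq, div_self (by positivity)]
  have hV : 12 < ∑ k ∈ A, x k / (1 + x k) ^ 2 := by
    have hsub : Wp J ⊆ A := fun k hk => hUpA (mem_biUnion.2 ⟨J, mem_range.2 hJm, hk⟩)
    have h1 : ∑ k ∈ Wp J, x k / (1 + x k) ^ 2 = (#(Wp J) : ℝ) * (1 / 4) := by
      rw [← nsmul_eq_mul, ← sum_const]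
      exact sum_congr rfl fun k hk => by rw [xWp J hJm k hk, hrJ]; norm_num
    have h2 : ∑ k ∈ Wp J, x k / (1 + x k) ^ 2 ≤ ∑ k ∈ A, x k / (1 + x k) ^ 2 :=
      sum_le_sum_of_subset_of_nonneg hsub fun k _ _ => by have := hx0 k; positivity
    have h3 := hslow J hJm
    rw [← hq] at h3
    have h4 : 48 < (#(Wp J) : ℝ) := by
      by_contra h
      nlinarith only [not_lt.1 h, h3, hL4, hq0, hσ0, hLr]
    linarith only [h1, h2, h4]
  -- admissibility of the gain amplitudes
  have hg0 : ∀ k ∈ A, 0 ≤ gw k := fun k _ => by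
    rw [hgw]; split_ifs
    · exact div_nonneg (hr0 _).le (by norm_num)
    · exact le_rfl
  have hga : ∀ k ∈ A, gw k ^ 2 * ((1 + x k) * (2 + x k)) ≤ x k := by
    intro k hkA
    by_cases hk : k ∈ Up ∪ Um
    · rcases mem_union.1 hk with hk1 | hk1
      · obtain ⟨j, hj, hkj⟩ := mem_biUnion.1 hk1
        rw [mem_range] at hj
        rw [gWp j hj k hkj, xWp j hj k hkj]
        exact adm_particle (hr0 j) (hr1 j hj)
      · obtain ⟨j, hj, hkj⟩ := mem_biUnion.1 hk1
        rw [mem_range] at hj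
        rw [gWm j hj k hkj, xWm j hj k hkj]
        exact adm_hole (hr0 j) (hr1 j hj)
    · rw [hgw, if_neg hk]
      simpa using hx0 k
  -- the trial state of Theorem 28(e)
  have hF : #F = M + 2 := hFn.trans hM
  have hAF' : #(A \ F) = M + 2 := hAF.trans hF
  have hsep' : ∀ k ∈ A \ F, μ ≤ torusBand L k := fun k hk => hFμ' k (mem_sdiff.1 hk).2
  have ht : 0 ≤ g / (L : ℝ) ^ 2 := by positivity
  obtain ⟨Ψ, hΨK, hΨ0, hΨ⟩ := trial_of_blocks hL3 F A hFA M hF hAF' μ hFμ hsep' col hfib a ha0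
    x hx0 hxP hxQ hV gw hg0 hga ht
  refine ⟨Ψ, by rw [hM]; exact hΨK, hΨ0, ?_⟩
  rw [← hFn, minEnergyOn_szSector_free_eq hL3 F μ hFμ hFμ']
  have hnn : 0 ≤ (star Ψ ⬝ᵥ Ψ).re := by
    have h := (Complex.lt_def.1 (Matrix.dotProduct_star_self_pos_iff.2 hΨ0)).1
    rw [Complex.zero_re] at h
    exact h.le
  refine hΨ.trans (mul_le_mul_of_nonneg_right ?_ hnn)
  -- THE ESTIMATE.  `S = Σ_j #W_j 4^j`.
  set S : ℝ := ∑ j ∈ range (J + 1), (#(Wp j) : ℝ) * 4 ^ j with hS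
  have hS0 : 0 ≤ S := sum_nonneg fun j _ => by positivity
  have hSlow : (J + 1) * (σ * (L : ℝ) ^ 2) ≤ S := by
    have := card_nsmul_le_sum (range (J + 1)) (fun j => (#(Wp j) : ℝ) * 4 ^ j) (σ * (L : ℝ) ^ 2)
      fun j hj => hslow j (mem_range.1 hj)
    rw [card_range, nsmul_eq_mul] at this
    push_cast at this
    exact this
  -- particles on the windows
  have hPw : ∑ k ∈ Up, (torusBand L k - μ) * (2 * x k / (1 + 2 * x k)) ≤ S / q ^ 2 := by
    rw [hUp, sum_biUnion hpdP, hS, sum_div]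
    refine sum_le_sum fun j hj => ?_
    rw [mem_range] at hj
    have hb : ∀ k ∈ Wp j, (torusBand L k - μ) * (2 * x k / (1 + 2 * x k)) ≤ 4 ^ j / q ^ 2 := by
      intro k hk
      rw [xWp j hj k hk]
      obtain ⟨h1, h2, -⟩ := hWp j k hk
      have e : 1 / 2 / 4 ^ j * (2 * r j ^ 2) = 4 ^ j / q ^ 2 := by
        rw [hr]
        field_simp
      exact (term_particle (by linarith only [h1]) (by linarith only [h2])).trans e.le
    have := sum_le_card_nsmul _ _ _ hb
    rw [nsmul_eq_mul] at this
    calc ∑ k ∈ Wp j, (torusBand L k - μ) * (2 * x k / (1 + 2 * x k))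
        ≤ #(Wp j) * (4 ^ j / q ^ 2) := this
      _ = #(Wp j) * 4 ^ j / q ^ 2 := by ring
  -- holes on the windows
  have hMw : ∑ k ∈ Um, (μ - torusBand L k) * (2 / (2 + x k)) ≤ S / q ^ 2 := by
    rw [hUm, sum_biUnion hpdM, hS, sum_div]
    refine sum_le_sum fun j hj => ?_
    rw [mem_range] at hj
    have hb : ∀ k ∈ Wm j, (μ - torusBand L k) * (2 / (2 + x k)) ≤ 4 ^ j / q ^ 2 := by
      intro k hk
      rw [xWm j hj k hk]
      obtain ⟨h1, h2, -⟩ := hWm j k hk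
      have e : 1 / 2 / 4 ^ j * (2 * r j ^ 2) = 4 ^ j / q ^ 2 := by
        rw [hr]
        field_simp
      exact (term_hole (by linarith only [h2]) (by linarith only [h1]) (hr0 j)).trans e.le
    have := sum_le_card_nsmul _ _ _ hb
    rw [nsmul_eq_mul, ← hcardW j] at this
    calc ∑ k ∈ Wm j, (μ - torusBand L k) * (2 / (2 + x k))
        ≤ #(Wp j) * (4 ^ j / q ^ 2) := this
      _ = #(Wp j) * 4 ^ j / q ^ 2 := by ring
  -- far particles and core holes
  have hRw : ∑ k ∈ R, (torusBand L k - μ) * (2 * x k / (1 + 2 * x k)) ≤ #R * (12 / X) := by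
    have hb : ∀ k ∈ R, (torusBand L k - μ) * (2 * x k / (1 + 2 * x k)) ≤ 12 / X := by
      intro k hk
      rw [xR k hk]
      have h1 := torusBand_le_four L k
      have h2 := hsep' k (hRA hk)
      exact term_far (by linarith only [h1, h2, hμ1]) hX0
    have := sum_le_card_nsmul _ _ _ hb
    rwa [nsmul_eq_mul] at this
  have hCw : ∑ k ∈ C, (μ - torusBand L k) * (2 / (2 + x k)) ≤ #C * (8 / X) := by
    have hb : ∀ k ∈ C, (μ - torusBand L k) * (2 / (2 + x k)) ≤ 8 / X := by
      intro k hk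
      rw [xC k hk]
      have h1 := neg_four_le_torusBand L k
      have h2 := hFμ k (hCF hk)
      exact term_core (by linarith only [h1, h2, hμ2]) hX0
    have := sum_le_card_nsmul _ _ _ hb
    rwa [nsmul_eq_mul] at this
  -- the gain
  have hG : 7 / 15 * (S / q) ≤ ∑ k ∈ A, |W[k]| * gw k := by
    have hUU : Disjoint Up Um := disjoint_left.2 fun k hk hk' => disjoint_left.1 hUpF hk (hUmF hk')
    have hsub : Up ∪ Um ⊆ A := union_subset hUpA (hUmF.trans hFA)
    have h1 : ∑ k ∈ Up ∪ Um, |W[k]| * gw k ≤ ∑ k ∈ A, |W[k]| * gw k :=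
      sum_le_sum_of_subset_of_nonneg hsub fun k hk _ => mul_nonneg (abs_nonneg _) (hg0 k hk)
    refine le_trans ?_ h1
    rw [sum_union hUU, hUp, hUm, sum_biUnion hpdP, sum_biUnion hpdM]
    have hbP : ∀ j ∈ range (J + 1), #(Wp j) * (7 / 30 * r j) ≤ ∑ k ∈ Wp j, |W[k]| * gw k := by
      intro j hj
      rw [mem_range] at hj
      have := card_nsmul_le_sum (Wp j) (fun k => |W[k]| * gw k) (7 / 30 * r j) fun k hk => by
        rw [gWp j hj k hk]
        have hw := (hWp j k hk).2.2
        have h0 := hr0 j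
        nlinarith only [seven_tenths_le_sqrt_two_div_two, hw, h0]
      rwa [nsmul_eq_mul] at this
    have hbM : ∀ j ∈ range (J + 1), #(Wp j) * (7 / 30 * r j) ≤ ∑ k ∈ Wm j, |W[k]| * gw k := by
      intro j hj
      rw [mem_range] at hj
      have := card_nsmul_le_sum (Wm j) (fun k => |W[k]| * gw k) (7 / 30 * r j) fun k hk => by
        rw [gWm j hj k hk]
        have hw := (hWm j k hk).2.2
        have h0 := hr0 j
        nlinarith only [seven_tenths_le_sqrt_two_div_two, hw, h0]
      rwa [nsmul_eq_mul, ← hcardW j] at this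
    have e : 7 / 15 * (S / q) = ∑ j ∈ range (J + 1), #(Wp j) * (7 / 30 * r j) +
        ∑ j ∈ range (J + 1), #(Wp j) * (7 / 30 * r j) := by
      rw [← two_mul, hS, sum_div, mul_sum, mul_sum]
      refine sum_congr rfl fun j _ => ?_
      rw [hr]; ring
    rw [e]
    exact add_le_add (sum_le_sum hbP) (sum_le_sum hbM)
  have hG0 : 0 ≤ 7 / 15 * (S / q) := mul_nonneg (by norm_num) (div_nonneg hS0 hq0.le)
  -- putting it together
  have hcost : 2 * ∑ k ∈ A \ F, (torusBand L k - μ) * (2 * x k / (1 + 2 * x k)) +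
      2 * ∑ k ∈ F, (μ - torusBand L k) * (2 / (2 + x k)) ≤ 4 * (S / q ^ 2) + 40 * #C / X := by
    rw [hAFeq, sum_union hdUR, hFeq, sum_union hdUC]
    have hRC' : (#R : ℝ) = #C := by exact_mod_cast hRC
    rw [hRC'] at hRw
    have h3 := add_le_add (mul_le_mul_of_nonneg_left (add_le_add hPw hRw) zero_le_two)
      (mul_le_mul_of_nonneg_left (add_le_add hMw hCw) zero_le_two)
    refine h3.trans (le_of_eq ?_)
    ring
  have hCn : (#C : ℝ) ≤ (L : ℝ) ^ 2 / 2 := by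
    have h1 : #C ≤ n := (card_le_card hCF).trans hFn.le
    have h1' : (#C : ℝ) ≤ n := by exact_mod_cast h1
    have h2' : (2 * n : ℝ) < (L : ℝ) ^ 2 := by exact_mod_cast h2n
    linarith only [h1', h2']
  have hfar : 40 * (#C : ℝ) / X ≤ κ * (L : ℝ) ^ 2 := by
    rw [hX, div_div_eq_mul_div, div_le_iff₀ (by norm_num : (0 : ℝ) < 20)]
    have := mul_le_mul_of_nonneg_right hCn hκ0.le
    linarith only [this]
  have hgain : g / (L : ℝ) ^ 2 * (7 / 15 * (S / q)) ^ 2 ≤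
      g / (L : ℝ) ^ 2 * (∑ k ∈ A, |W[k]| * gw k) ^ 2 :=
    mul_le_mul_of_nonneg_left (pow_le_pow_left₀ hG0 hG 2) ht
  have hSlow' : (J + 1) * σ * (L : ℝ) ^ 2 ≤ S := by rw [mul_assoc]; exact hSlow
  have hS8 : 8 * (L : ℝ) ^ 2 ≤ 49 * g / 225 * S := by
    have h1 : 49 * g / 225 * ((J + 1) * σ * (L : ℝ) ^ 2) ≤ 49 * g / 225 * S :=
      mul_le_mul_of_nonneg_left hSlow' (by positivity)
    have hJ' : 8 ≤ 49 * g / 225 * ((J + 1) * σ) := by rw [hσ]; exact hJ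
    have h0 := mul_le_mul_of_nonneg_right hJ' (sq_nonneg (L : ℝ))
    calc 8 * (L : ℝ) ^ 2 ≤ 49 * g / 225 * ((J + 1) * σ) * (L : ℝ) ^ 2 := h0
      _ = 49 * g / 225 * ((J + 1) * σ * (L : ℝ) ^ 2) := by ring
      _ ≤ 49 * g / 225 * S := h1
  have hmain : 4 * (S / q ^ 2) - g / (L : ℝ) ^ 2 * (7 / 15 * (S / q)) ^ 2 ≤
      -(4 * ((J + 1) * σ) / q ^ 2) * (L : ℝ) ^ 2 :=
    main_ineq hS0 hq0 (by positivity) hSlow' hS8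
  have hκ' : 3 * (J + 1) / (1024 * π ^ 2 * 16 ^ J) = κ := by
    have h16 : (16 : ℝ) ^ J = q ^ 2 := by
      rw [hq, ← pow_mul, mul_comm, pow_mul]
      norm_num
    rw [h16, hκ, hσ]
    field_simp
    ring
  have hκ2 : -(4 * ((J + 1) * σ) / q ^ 2) * (L : ℝ) ^ 2 = -(2 * κ * (L : ℝ) ^ 2) := by
    rw [hκ]
    ring
  rw [hκ2] at hmain
  have key : 2 * ∑ k ∈ A \ F, (torusBand L k - μ) * (2 * x k / (1 + 2 * x k)) +
      2 * ∑ k ∈ F, (μ - torusBand L k) * (2 / (2 + x k)) -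
        g / (L : ℝ) ^ 2 * (∑ k ∈ A, |W[k]| * gw k) ^ 2 ≤ -(κ * (L : ℝ) ^ 2) :=
    calc _ ≤ 4 * (S / q ^ 2) + 40 * (#C : ℝ) / X - g / (L : ℝ) ^ 2 * (7 / 15 * (S / q)) ^ 2 :=
          sub_le_sub hcost hgain
      _ ≤ 4 * (S / q ^ 2) + κ * (L : ℝ) ^ 2 - g / (L : ℝ) ^ 2 * (7 / 15 * (S / q)) ^ 2 :=
          sub_le_sub_right (add_le_add le_rfl hfar) _
      _ = 4 * (S / q ^ 2) - g / (L : ℝ) ^ 2 * (7 / 15 * (S / q)) ^ 2 + κ * (L : ℝ) ^ 2 := by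
          ring
      _ ≤ -(2 * κ * (L : ℝ) ^ 2) + κ * (L : ℝ) ^ 2 := add_le_add hmain le_rfl
      _ = -(κ * (L : ℝ) ^ 2) := by ring
  rw [hκ', add_sub_assoc, sub_eq_add_neg (2 * ∑ k ∈ F, torusBand L k) (κ * (L : ℝ) ^ 2)]
  exact add_le_add le_rfl key

end Summit.HubbardSuperconductivity.HubbardSuperconductivity.Theorems.CooperPairing
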